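import Summits.QuantumFields.YangMills.Theorems.UnitScaleTiltProp7StubEXOfChartPiecesTwS55G
import Summits.QuantumFields.YangMills.Theorems.UnitScaleTiltMinimiserStabilityRegPrGuardedOfExistence
import HarnessLib

/-!
# Route `UnitScaleTilt`, crux K1 «MinimiserStabilityRegPr» (stmt-QuantumFields-19200) — **THE Sᵍ-TOP INSTANTIATED FACE: [Balaban1985Variational] PROP. 7's EXISTENCE CLAUSE (the EX body)
# FOR SU(2), d = 3, AT EVERY BLOCK SIZE L ≥ 5 — OUTRIGHT, NO HYPOTHESIS; the crux's L ≥ 5 body OUTRIGHT; print's admissible-block rung leaf `YM3TorusSU2Adm` modulo the two sibling cruxes ONLY**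
# (chair ★p1 g29 WORD №76 (3) ∕ ★★OWNER g38 №170 (4) ∕ RULINGS №55–№56 «guarded chain»; width seat `ym3-torus-px16 g16`)

Cell `ym3-torus` (HUMAN RULING D-0037; rung R3 = SU(2) YM₃ on T³ — NOT d = 4, NOT infinite volume, NOT a mass gap, NOT Clay).  THEOREMS ONLY (0 `def`, 0 `sorry`, 0 `instance`);
ONE decl-local `maxHeartbeats 400000` on §1 (README №24 class: one `exact` through the guarded display by name); `--supports stmt-QuantumFields-19200 --as helper`, count-neutral.

WHAT THIS IS.  The GUARDED edition line Sᵍ (RULING №55; px10 g15 generator of record, 22 twins `…_g5` of the EX display chain with ONE guard `5 ≤ L →` threaded from the root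
✓`…DisplayedRowsWWSECtrDLift` to the top) ends at ✓`stubEX_of_chartPiecesTwS55G` (✓p790443), whose [Balaban1985RegularSpaces]-Thm-2 socket is DISCHARGED inside by ★p1 g29 ✓`Prop7Thm2SocketOfCoverForm.hThm2S_body_of_five_le`
(lit-balaban's binder-free cover form ✓p720401 `B8Thm2TorusCoverOfProp6DeltaA.hThm2Cover_of_prop6_deltaA` + ym-inputs ✓`thm2TorusAt_of_dvd'`) and whose H-storey group is DISCHARGED by px17 g13
✓`hHωw_family_exists` — so its display is PARAMETERS ONLY: `[hFL hFη] αcap hαcap c₀ cB [hc₀ hcB] a ha A₁ hA₁`.  THIS FILE chooses them (`hFL`∕`hFη` from `T3Family.hL`, `αcap := 1`,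
`c₀ = cB := 1`, `a L i := (1∕1)·(L^{K−n})³` so `ha := le_rfl`, `A₁ := 1`) and reads off:
* §1 ★★★★ `exBody_guarded_five : ∀ L, 1 < L → 5 ≤ L → ⟨the EX body f199ee1aea9feec8 from `∀ B₃` on⟩` — the registered stub `stub_existenceMinimalOrbit`'s text with the single insertion `5 ≤ L →`
  (EXᵍ body of record 1d21711c5018adbe, ★★OWNER №169∕№170) — **NO HYPOTHESIS**;
* §2 ★★★★ `minimiserStabilityRegPr_guarded_five : ∀ L, 5 ≤ L → ⟨the crux `MinimiserStabilityRegPr`'s body at L⟩` := ✓p783056 `MinimiserStabilityRegPrGuarded.minimiserStabilityRegPr_guarded_of_existence5` §1 —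
  **NO HYPOTHESIS** (H = ✓p705908 `stub_halvingStep` inside);
* §3 ★★★ `ym3TorusSU2Adm_of_siblings (h201 : Theses.UnitScaleTilt.FluctuationComparisonRegPrIntL) (hK2 : Theses.UnitScaleTilt.HistoryTailL) : T3YM3TorusStatement.YM3TorusSU2Adm` := ✓p783056 §3 —
  print's admissible-block leaf ([Balaban1987RG1] §0 p.251 «L an odd positive integer > 11») modulo EXACTLY the two sibling crux decls of the route, BY NAME;
* §4 ★★★ `ym3TorusSU2At_of_siblings (L₀) (h5 : 5 ≤ L₀) (h201) (hK2) : T3YM3TorusStatement.YM3TorusSU2At L₀` := socket v1.1 §4 `ym3TorusSU2At_of_existence5` — the fixed-block-size leaf at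
  EVERY `L₀ ≥ 5` modulo the same two sibling cruxes (the finer reading; the leaf of record `YM3TorusSU2` differs exactly by the L₀ = 3 families).

WHAT THIS IS NOT.  NOT a proof of `stub_existenceMinimalOrbit` ∕ crux 19200 `MinimiserStabilityRegPr` ∕ `YM3TorusSU2` AS REGISTERED (all L > 1): the L = 3 class is NOT covered (located residue
LF-1EX — lit-balaban's `KIdx.hℓ : 4 ≤ ℓ` + [Balaban1985BackgroundPropagators] Cor. 3.6 window, px21 g17 LOCATE-L3 3cc46db7; cure = L = 3 re-edition or the post-freeze re-cut docket (5)(ii)); NOT a display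
flip; NOT a registry ∕ route ∕ `closes` event (J-FREEZE to 2026-09-02 honoured); §3 is CONDITIONAL on the two OPEN sibling cruxes (20520, 19936).  It CREDITS NOTHING to any item.
HONEST READING FOR THE BOOKS (RULING №55 (4)): «[Balaban1985Variational] Prop. 7 existence clause, SU(2), d = 3, every block size L ≥ 5: OUTRIGHT; crux 19200's L ≥ 5 body: OUTRIGHT;
print's admissible-block leaf ⟸ {20520, 19936}» — and NOT «19200 closed».  Rung R3 = SU(2) YM₃ on T³ — NOT d = 4, NOT infinite volume, NOT a mass gap, NOT Clay; the YM mass gap is NOT proved.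
References: T. Bałaban, CMP 102 (1985) 277–309 [Balaban1985Variational] (Thm 1 (6)–(10) pp.278–279, Prop. 7 p.299, Prop. 8 p.304); CMP 99 (1985) 75–102 [Balaban1985RegularSpaces] (Thm 2 p.83);
CMP 99 (1985) 389–434 [Balaban1985BackgroundPropagators] (Thm 3.1 pp.397–398, Thm 3.3 p.399, Thm 3.10 pp.414–416); CMP 109 (1987) 249–301 [Balaban1987RG1] (§0 p.251); CMP 102 (1985) 255–275 [Balaban1985UV3] ((1)–(3) p.256).
-/

set_option autoImplicit false

noncomputable section


open scoped BigOperators Matrix.Norms.L2Operator Matrix InnerProductSpace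

namespace Summit.QuantumFields.YangMills.Theorems.EXGuardedFiveOutright

open NormedSpace
open Literature.Analysis.Calculus.ExpDifferential (ad gSer)
open Literature.MathematicalPhysics.QuantumFieldTheory.Balaban1983to89
open Literature.MathematicalPhysics.QuantumFieldTheory.Balaban1983to89.T3ContinuumYM3Torus
open Literature.MathematicalPhysics.QuantumFieldTheory.Balaban1983to89.T3UnitLawDensityEML (ℰp)
open Literature.MathematicalPhysics.QuantumFieldTheory.Balaban1983to89.T3TiltDescent (descendTo)
open Literature.MathematicalPhysics.QuantumFieldTheory.Balaban1983to89.T3ConstrainedMinimiser (fibre)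
open Literature.MathematicalPhysics.QuantumFieldTheory.Balaban1983to89.T3PrintedRegularMinimiser (RegPr regFibrePr)
open Literature.MathematicalPhysics.QuantumFieldTheory.Balaban1983to89.T3Thm1Carrier
open Literature.MathematicalPhysics.QuantumFieldTheory.Balaban1983to89.T3SectALandauChart (In19 emb15 CloseAvg eta bgUnits pert)
open B9SectCLatticeCarrier (Bond)
open B9Eq311L2Pairing (WL2)
open B10Eq27TorusAxialLog (unitsField toUField pull transl holT)
open B11Eq115Space (NegSup NegSize Space115 JetSup levWeight)
open B11Eq111FrakG (nabla115)
open B11Eq98CurrentSlot (Jcur)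
open B11Eq103H1Complex (BondL2K funEquiv SiteL2K laplaceAK)
open B11Prop3Model (Dfix)
open B13Contraction113 (QuadAnalytic)
open B8Thm2SetupTorus (Thm2SetupSUAt)
open MatrixLog (mlog)
open Summit.QuantumFields.YangMills.Theorems.Prop7TPrint (nMax19 expHermField)
open Summit.QuantumFields.YangMills.Theorems.Prop7SPrint (NormS IsLandauPrintS basePt RestrictedPrint isLandauPrintS_iff_RS AvgCondPrint IsLandauPrint)
open Summit.QuantumFields.YangMills.Theorems.Prop7SectET3Transport (periodsT3 bgOfCfg bondEquiv)
open Summit.QuantumFields.YangMills.Theorems.Prop7SectET3HilbertLetters (W₂ toL2 toL2B DL2 DstarL2 frobEquiv covLapSite toL2S)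
open Summit.QuantumFields.YangMills.Theorems.Prop7SectET3GaugeProjector (RS)
open Summit.QuantumFields.YangMills.Theorems.Prop7SymAvgTwSym (QTwS CmapTwS Chart47T3twS)
open Summit.QuantumFields.YangMills.Theorems.Prop7SymAvgGL (QSym descendToGL)
open Summit.QuantumFields.YangMills.Theorems.Prop7SectET3CurvedPropagators (laplaceA PosOnto frakGfR H1f QTwS_Hf Qk GT KinvT)
open Summit.QuantumFields.YangMills.Theorems.Prop7SectET3DeltaPiPInv (DeltaPiSlotP H46P inner_DL2_DeltaPiP_eq_zero GprimeP)
open Summit.QuantumFields.YangMills.Theorems.Prop7SectET3DeltaOnePInv (DeltaOnePJ TJSlotP DeltaOneP_kills_NS inner_DL2_DeltaOneP_eq_zero)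
open Summit.QuantumFields.YangMills.Theorems.Prop7HDsolAtRecordOfRowsTwoSlotFamilyLLift (hΔsol_of_opRows_twoSlot_familyL)
open Summit.QuantumFields.YangMills.Theorems.Prop7HWROfRowsFamily (hWR_of_rows_family)
open Summit.QuantumFields.YangMills.Theorems.Prop7Prop4OfW80RowsAtRecord (prop4_W80_family)
open Summit.QuantumFields.YangMills.Theorems.Prop7DeltaEtaHfCompositeNorm (hN₁_family_of_rows)
open Summit.QuantumFields.YangMills.Theorems.Prop7RieszTauFrobNorm (opNorm_rieszτ_frobEquiv_le_one opNorm_trace_clm_le_two hqV_record_family)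
open Summit.QuantumFields.YangMills.Theorems.Prop7V0CurrentReality (hV0_of_RC_family)
open Summit.QuantumFields.YangMills.Theorems.Prop7ThetaOfColumnLettersT3 (theta_rows_family_of_columnLetters)
open Summit.QuantumFields.YangMills.Theorems.Prop7RCOfRowsFamily (hRC_of_rows_family_B₀)
open Summit.QuantumFields.YangMills.Theorems.Prop7RealityRowsFamily (hHfR_family hH₁R_family h𝒢R_family)
open B11Eq63V0GroupCurrent (curV0)
open B11Eq80Current (Emap E3 W80)
open B11Eq90Transpose (kernel single115)
open B11Eq90V0primeCurrent (flat115)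
open B11Eq174Chart (Regime)
open B11Eq90V0GroupComposed (curV0full T47)
open Summit.QuantumFields.YangMills.Theorems.Prop7SectET3EXJunction (h102_of_posOnto h129_of_posOnto h45_of_posOnto h102LS_of_posOnto h129LS_of_posOnto)
open Summit.QuantumFields.YangMills.Theorems.Prop7H46GradRow (h46_rows_of_norm115)
open Summit.QuantumFields.YangMills.Theorems.Prop7QkOntoOfRegPr (surjective_Qk_of_regPr)
open T3SectALandauChart (bgUnits covGradT covCodiffCurlT covLapFormT)

open Summit.QuantumFields.YangMills.Theorems.Prop7SectET3WilsonHessian (DeltaEta DeltaEtaSlot)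
open Summit.QuantumFields.YangMills.Theorems.Prop7H46TwoOfOpRowsFamily (hBH₂_of_nonneg)
open Summit.QuantumFields.YangMills.Theorems.Prop7HDsolAtRecordOfRowsFamily (hMΔ_of_nonneg)
open Summit.QuantumFields.YangMills.Theorems.Prop7H46PTwoOfOpRowsFamily (h46₂P_of_opRows_family)

open B11Eq98V0primeCurrentSlots (rieszτ)
open B9Eq3119DeltaPiCarrier (currentCLM)
open Summit.QuantumFields.YangMills.Theorems.Prop7ColumnRowsOfKernelDecay (hHcol_of_kernel133_family hΔHcol_of_kernel88_family thetaH_nonneg thetaΔ_nonneg)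
open Summit.QuantumFields.YangMills.Theorems.Prop7Op349OfKernelRow (hOp349_of_kernel349_family k349_nonneg)
open Summit.QuantumFields.YangMills.Theorems.Prop7PA2OfSymDiffDivRows (hPA2_of_symL1_diffL1_divSlice)
open Summit.QuantumFields.YangMills.Theorems.Prop7DivSliceRowHolds (hV_holds)
open Summit.QuantumFields.YangMills.Theorems.Prop7HcoSOfNormG0DiffRow (hS_holds)
open Summit.QuantumFields.YangMills.Theorems.Prop7StubEXOfChartPiecesTwS25LLift (stubEX_of_chartPiecesTwS25L)
open Summit.QuantumFields.YangMills.Theorems.Prop7Op139OfGaugeColumnLift (hOp139π_of_gaugeColumn_family)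
open Summit.QuantumFields.YangMills.Theorems.Prop7Op139OfGaugeColumn (k139_nonneg)
open Summit.QuantumFields.YangMills.Theorems.Prop7DivRecoveryPatchRows (patch_rows)
open Summit.QuantumFields.YangMills.Theorems.Prop7QH1DoorHolds (hQH1_doorH_holds)
open Summit.QuantumFields.YangMills.Theorems.Prop7HN06OfPatch (hN06_of_patchRows)
open Summit.QuantumFields.YangMills.Theorems.Prop7CombHMc2Holds (hMc₂_holds)
open Summit.QuantumFields.YangMills.Theorems.Prop7N32SymRow (hN2s_holds)
open Summit.QuantumFields.YangMills.Theorems.Prop7CombHMcombHolds (hMcomb_holds)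
open Literature.MathematicalPhysics.QuantumLattice (blockBase)
open T3LevelShift (bondShift siteShift)
open B7Eq78Linearization (conjR)
open B7Prop1Explicit (U1 expUnit)
open T4TermwiseTorus (tlift)
open Summit.QuantumFields.YangMills.Theorems.Prop7QprimeCombL2 (RcombL2)
open B7Eq92Concrete (tildIter)
open BlockAveragingEMLLinearisedBackground (pertVar)
open ExpMeanLog (expMeanLogSU)
open BlockAveraging (blockAvg)
open Summit.QuantumFields.YangMills.Theorems.Prop7CovKernel157Family (hC157_family)
open B9Eq39Adjoint (curl divB)
open B9TorusCalculus (torusT)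
open Summit.QuantumFields.YangMills.Theorems.Prop7SectET3CombLetters (Qkc)
open Summit.QuantumFields.YangMills.Theorems.Prop7SymAvgTw (CmapTw)
open Summit.QuantumFields.YangMills.Theorems.Prop7CcolOf157Entry (hCcol_of_157_family hG0_of_hg0)
open Prop8Chart (emlIterU)
open B15DeterminingSets (embIter)
open Summit.QuantumFields.YangMills.Theorems.Prop7Op137OfKernelRows (h137π_of_kernel137_family h137Δ_of_kernel137_family hOpC_of_kernelC_family)
open B5Eq118OneStroke (iterBlockOf)
open T3PrintedRegularOrbits (sites_eq)
open Summit.QuantumFields.YangMills.Theorems.Prop7CmapTwSupRow (hcoS_of_normG0_of_combRemainderL1Rows)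
open Summit.QuantumFields.YangMills.Theorems.Prop7HDOfCombRows (hD_of_hMcomb)
open Summit.QuantumFields.YangMills.Theorems.Prop7IrrLiftRowOfRecord (hIrrLift_of_record)
open Summit.QuantumFields.YangMills.Theorems.Prop7EXNumeralRowsInhabited (ex_numeral_rows_inhabited)

open Summit.QuantumFields.YangMills.Theorems.Prop7StubEXOfChartPiecesTwS43LT2 (stubEX_of_chartPiecesTwS43LT2)
open Summit.QuantumFields.YangMills.Theorems.Prop7PositivityBlockDoorLiftedRows (positivityRows_lift_of_liftedRows)
open Summit.QuantumFields.YangMills.Theorems.Prop7TJRowOfEntry157Lift (hTJ_of_hHcol_h157)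
open Summit.QuantumFields.YangMills.Theorems.Prop7ColumnRowsOfKernelDecayLift (hHcol_of_kernel133_family)

open Summit.QuantumFields.YangMills.Theorems.Prop7StubEXOfChartPiecesTwS44LG (stubEX_of_chartPiecesTwS44LG)
open Summit.QuantumFields.YangMills.Theorems.Prop7GaugeFixedRowDoorOfLODTarget (gaugeFixedRow_idx_of_curvedTarget_of_le_coupling)
open T3PrintedMinimiserExistence (regPr_mono)
open B7TransferAnalyticMean (meanCLM)
open B11Eq103H1Complex (projR)
open Summit.QuantumFields.YangMills.Theorems.Prop7SectET3GaugeProjector (NS)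
open B7Prop1Explicit (disp)
open T4Continuum BlockAveraging

open Summit.QuantumFields.YangMills.Theorems.Prop7StubEXOfChartPiecesTwS45 (stubEX_of_chartPiecesTwS45)
open Summit.QuantumFields.YangMills.Theorems.Prop7KernelRow349DoorOfLODTarget (kernelRow349_idx_of_projRTarget)
open T3PrintedMinimiserExistence (regPr_mono)
open B7TransferAnalyticMean (meanCLM)
open B11Eq103H1Complex (projR)
open Summit.QuantumFields.YangMills.Theorems.Prop7SectET3GaugeProjector (NS)
open B7Prop1Explicit (disp)
open T4Continuum BlockAveraging

open Summit.QuantumFields.YangMills.Theorems.Prop7StubEXOfChartPiecesTwS46 (stubEX_of_chartPiecesTwS46)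
open T3PrintedMinimiserExistence (regPr_mono)
open B7TransferAnalyticMean (meanCLM)
open B11Eq103H1Complex (projR)
open Summit.QuantumFields.YangMills.Theorems.Prop7SectET3GaugeProjector (NS)
open B7Prop1Explicit (disp)
open T4Continuum BlockAveraging
open Summit.QuantumFields.YangMills.Theorems.Prop7StubEXOfChartPiecesTwS47 (stubEX_of_chartPiecesTwS47)
open Summit.QuantumFields.YangMills.Theorems.Prop7H133FamilyPackageAllMembers (h133_family_exists_allMembers h137kpi_family_exists_allMembers)
open T3PrintedMinimiserExistence (regPr_mono)
open Summit.QuantumFields.YangMills.Theorems.Prop7StubEXOfChartPiecesTwS48 (stubEX_of_chartPiecesTwS48)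
open Summit.QuantumFields.YangMills.Theorems.Prop7NormHpiFamilyPackageAllMembers (normHpi_family_exists_allMembers)
open Summit.QuantumFields.YangMills.Theorems.Prop7H88FamilyPackageAllMembers (h88_family_exists_allMembers)
open Summit.QuantumFields.YangMills.Theorems.Prop7KRows78EtaTJFamilyPackageAllMembers (hCk_family_exists_allMembers)
open Summit.QuantumFields.YangMills.Theorems.Prop7KRows78EtaTJFamilyPackageAllMembers (h137kDelta_family_exists_allMembers)
open T3PrintedMinimiserExistence (regPr_mono)
open Summit.QuantumFields.YangMills.Theorems.Prop7StubEXOfChartPiecesTwS49 (stubEX_of_chartPiecesTwS49)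
open Summit.QuantumFields.YangMills.Theorems.Prop7NormHoneFamilyPackageAllMembers (normHone_family_exists_allMembers)
open Summit.QuantumFields.YangMills.Theorems.Prop7SectET3DeltaOne (avgHess)
open T3PrintedMinimiserExistence (regPr_mono)
open Summit.QuantumFields.YangMills.Theorems.Prop7StubEXOfChartPiecesTwS50 (stubEX_of_chartPiecesTwS50)
open Summit.QuantumFields.YangMills.Theorems.Prop7NormGFamilyPackageAllMembers (normG_family_exists_allMembers)
open Summit.QuantumFields.YangMills.Theorems.Prop7SectET3DeltaOnePInv (DeltaOneP)
open T3PrintedMinimiserExistence (regPr_mono)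
open Summit.QuantumFields.YangMills.Theorems.Prop7StubEXOfChartPiecesTwS51 (stubEX_of_chartPiecesTwS51)
open Summit.QuantumFields.YangMills.Theorems.Prop7StoreyHGradientFamily (h3_family_exists)
open B10Eq27TorusAxialLog (axialT)
open B4Sect5Torus (TSite tdist)
open Summit.QuantumFields.YangMills.Theorems.Prop7SectET3Transport (siteEquiv)
open Summit.QuantumFields.YangMills.Theorems.CoverSites
open Summit.QuantumFields.YangMills.Theorems.Prop7StubEXOfChartPiecesTwS52 (stubEX_of_chartPiecesTwS52)
open Summit.QuantumFields.YangMills.Theorems.Prop7AvgHessGaugeHqGClosed (hqG_family_closed qG_family_closed_nonneg)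
open Summit.QuantumFields.YangMills.Theorems.Prop7StubEXOfChartPiecesTwS53 (stubEX_of_chartPiecesTwS53)
open Summit.QuantumFields.YangMills.Theorems.Prop7Thm2SocketOfCoverForm (hThm2S_of_three)
open B8Thm2SetupTorus (Thm2SetupSUAt)
open Summit.QuantumFields.YangMills.Theorems.Prop7StubEXOfChartPiecesTwS54 (stubEX_of_chartPiecesTwS54)
open Summit.QuantumFields.YangMills.Theorems.Prop7StubEXOfChartPiecesTwS53G (stubEX_of_chartPiecesTwS53G)
open Summit.QuantumFields.YangMills.Theorems.Prop7Thm2SocketOfCoverForm (hThm2S_body_of_five_le)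
open Summit.QuantumFields.YangMills.Theorems.Prop7OmegaOneAxialHolderFamily (hHωw_family_exists)


open Summit.QuantumFields.YangMills.Theorems.Prop7StubEXOfChartPiecesTwS55G (stubEX_of_chartPiecesTwS55G)
open Summit.QuantumFields.YangMills.Theorems.MinimiserStabilityRegPrGuarded (minimiserStabilityRegPr_guarded_of_existence5 ym3TorusSU2Adm_of_existence5 ym3TorusSU2At_of_existence5)
open T3PrintedRegularMinimiser (MinimiserStabilityRegPrAt)
open Literature.MathematicalPhysics.QuantumFieldTheory.Balaban1983to89.T3YM3TorusStatement (YM3TorusSU2Adm YM3TorusSU2At)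

/-! ## §1 The EX body at every block size L ≥ 5 — outright -/

set_option maxHeartbeats 400000 in
-- hb: one `exact` through the guarded display by name (README №24 class).
/-- ★★★★ **[Balaban1985Variational] PROP. 7's EXISTENCE CLAUSE (the registered EX text with the guard `5 ≤ L`), SU(2), d = 3 — NO HYPOTHESIS.**  For every block size `L ≥ 5` and
`B₃ > 4` there are `a₁′ > 0`, `O₁ ≥ 1` such that at every member `(F, n < K)`, every (7)-small `V`, every background `U₀ ∈ 𝔘_k(L³B₃ε₁) ∩ 𝔅_k(V)`, `ε₁ ≤ a₁′`, the Wilson action has a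
MINIMISER over print's regular fibre (6)(O₁L³B₃ε₁).  Proof = ✓`stubEX_of_chartPiecesTwS55G` with its parameter letters chosen (`αcap := 1`, `c₀ = cB := 1`, `a := (L^{K−n})³`, `A₁ := 1`).
[cite: Balaban1985Variational, Prop. 7 p.299, Thm 1 (8) p.279, (14) p.280; Balaban1985RegularSpaces, Thm 2 p.83; Balaban1985BackgroundPropagators, Thm 3.3 p.399] -/
theorem exBody_guarded_five :
    ∀ (L : ℕ), 1 < L → 5 ≤ L → ∀ (B₃ : ℝ), 4 < B₃ → ∃ a₁' O₁ : ℝ, 0 < a₁' ∧ 1 ≤ O₁ ∧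
    ∀ (F : T3Family), F.L = L → ∀ (n K : ℕ) (hnK : n < K) (ε₁ : ℝ), 0 < ε₁ →
      ∀ V : GaugeField (F.P n) 0 (Matrix.specialUnitaryGroup (Fin 2) ℂ), PlaqSmall ε₁ V →
        ∀ U₀ : GaugeField (F.P K) 0 (Matrix.specialUnitaryGroup (Fin 2) ℂ), RegPr F n K ((L : ℝ) ^ 3 * B₃ * ε₁) U₀ → U₀ ∈ fibre F ℰp n K hnK.le V →
          ε₁ ≤ a₁' → ∃ U ∈ regFibrePr F n K hnK.le (O₁ * (L : ℝ) ^ 3 * B₃ * ε₁) V,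
            IsMinOn (fun W : GaugeField (F.P K) 0 (Matrix.specialUnitaryGroup (Fin 2) ℂ) => wilsonAction4 W)
              (regFibrePr F n K hnK.le (O₁ * (L : ℝ) ^ 3 * B₃ * ε₁) V) U := by
  haveI hFL : ∀ F : T3Family, Fact (0 < (F.L : ℝ)) := fun F => ⟨by have h := F.hL.2; exact_mod_cast (lt_trans zero_lt_one h)⟩
  haveI hFη : ∀ (F : T3Family) (k : ℕ), Fact (0 < ((F.L : ℝ)⁻¹) ^ k) := fun F k => ⟨pow_pos (inv_pos.mpr (hFL F).out) k⟩
  haveI hone : ∀ L : ℕ, Fact (0 < ((fun _ : ℕ => (1 : ℝ)) L)) := fun _ => ⟨one_pos⟩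
  have hA₁' : ∀ L : ℕ, 1 < L → ∀ i : Idx L, (fun (L : ℕ) (i : Idx L) => ((1 : ℝ) / 1) * ((i.1.1.L : ℝ) ^ (i.1.2.2 - i.1.2.1)) ^ 3) L i ≤
      (1 : ℝ) * (((1 : ℝ) / 1) * ((i.1.1.L : ℝ) ^ (i.1.2.2 - i.1.2.1)) ^ 3) := fun L hL i => by
    simp only [one_mul, le_refl]
  exact stubEX_of_chartPiecesTwS55G (fun _ => (1 : ℝ)) (fun L hL => one_pos) (fun _ => (1 : ℝ)) (fun _ => (1 : ℝ))
    (fun (L : ℕ) (i : Idx L) => ((1 : ℝ) / 1) * ((i.1.1.L : ℝ) ^ (i.1.2.2 - i.1.2.1)) ^ 3) (fun L i => le_rfl) (1 : ℝ) hA₁'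

/-! ## §2 The crux's L ≥ 5 body — outright -/

/-- ★★★★ **THE CRUX `MinimiserStabilityRegPr`'s BODY AT EVERY BLOCK SIZE L ≥ 5 — NO HYPOTHESIS** (✓p783056 §1 `minimiserStabilityRegPr_guarded_of_existence5` ∘ §1; H = ✓`stub_halvingStep` inside).
NOT the registered crux (which asks every L > 1; L = 3 = LF-1EX residue). [cite: Balaban1985Variational, Thm 1 (6)-(10) pp.278-279, Prop. 7 p.299, Prop. 8 p.304; Balaban1985RegularSpaces, Thm 2 p.83] -/
theorem minimiserStabilityRegPr_guarded_five :
    ∀ (L : ℕ), 5 ≤ L → ∃ ε₁ : ℝ, 0 < ε₁ ∧ ∀ (ε₀ : ℝ), 0 < ε₀ → ε₀ ≤ ε₁ → ∃ m₀ : ℕ, ∀ (m : ℕ), m₀ ≤ m →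
      ∀ (b₀ p₀ : ℝ), 0 < b₀ → 2 < p₀ → ∃ γ₁ : ℝ, 0 < γ₁ ∧ ∀ (F : T3Family) (γ : ℝ), F.L = L → 0 < γ → γ ≤ γ₁ →
        MinimiserStabilityRegPrAt F γ b₀ p₀ m ε₀ :=
  minimiserStabilityRegPr_guarded_of_existence5 exBody_guarded_five

/-! ## §3 Print's admissible-block rung leaf modulo the two sibling cruxes -/

/-- ★★★ **`YM3TorusSU2Adm` ⟸ `FluctuationComparisonRegPrIntL` (20520) ∧ `HistoryTailL` (19936), NOTHING ELSE** (✓p783056 §3 ∘ §1): print's own letter for the rung ([Balaban1987RG1] §0 p.251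
«L is an odd, positive integer > 11») BY NAME from the two OPEN sibling crux decls of route `UnitScaleTilt`.  CONDITIONAL; credits nothing; not `YM3TorusSU2` (all odd L > 1).
[cite: Balaban1987RG1, §0 p.251; Balaban1985UV3, (1)-(3) p.256; Balaban1985Variational, Prop. 7 p.299] -/
theorem ym3TorusSU2Adm_of_siblings
    (h201 : Summit.QuantumFields.YangMills.Theses.UnitScaleTilt.FluctuationComparisonRegPrIntL)
    (hK2 : Summit.QuantumFields.YangMills.Theses.UnitScaleTilt.HistoryTailL) : YM3TorusSU2Adm :=
  ym3TorusSU2Adm_of_existence5 exBody_guarded_five h201 hK2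

/-! ## §4 The fixed-block-size leaf at every L₀ ≥ 5 modulo the two sibling cruxes (chair ★p1 g29 socket v1.1 §4) -/

/-- ★★★ **`YM3TorusSU2At L₀` FOR EVERY BLOCK SIZE `L₀ ≥ 5` ⟸ `FluctuationComparisonRegPrIntL` (20520) ∧ `HistoryTailL` (19936), NOTHING ELSE** (✓`ym3TorusSU2At_of_existence5` (socket v1.1 §4) ∘ §1):
continuum SU(2) YM₃ on the three-tori of block size `L₀` — the finer reading than §3 (serves L₀ = 5, 7, 9, 11 as well).  CONDITIONAL on the two OPEN sibling crux decls; credits nothing;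
not the leaf of record `YM3TorusSU2` (all odd L > 1 — differs exactly by the L₀ = 3 families). [cite: Balaban1985UV3, (1)-(3) p.256; Balaban1985Variational, Prop. 7 p.299; Balaban1987RG1, §0 p.251] -/
theorem ym3TorusSU2At_of_siblings (L₀ : ℕ) (h5 : 5 ≤ L₀)
    (h201 : Summit.QuantumFields.YangMills.Theses.UnitScaleTilt.FluctuationComparisonRegPrIntL)
    (hK2 : Summit.QuantumFields.YangMills.Theses.UnitScaleTilt.HistoryTailL) : YM3TorusSU2At L₀ :=
  ym3TorusSU2At_of_existence5 L₀ h5 exBody_guarded_five h201 hK2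

end Summit.QuantumFields.YangMills.Theorems.EXGuardedFiveOutright

end
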